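import Mathlib
import HarnessLib
import Summits.Ventures.LatticeQCDFlow.Scaling.AcceptanceEssEightNinthsDensities
import Summits.Ventures.LatticeQCDFlow.Scaling.MidrankIntegral

/-!
# LatticeQCDFlow / Scaling — the GINI acceptance floor `ā ≥ 1 − √((1/κ − 1)/3)` and the exact
# acceptance-vs-ESS ENVELOPE `max((8/9)κ, 1 − √((1/κ − 1)/3)) ≤ ā` on a GENERAL measure space

HONEST FRAMING: exact (Metropolis-corrected) sampling algorithms for lattice gauge theory;
figures of merit are autocorrelation/cost numbers at stated couplings and volumes; no
continuum-physics claim.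

Venture `LatticeQCDFlow` (cell pub-lqcd), topic `Scaling`; FANOUT row 3 (`s0-u1-a`, S0-B
implementation A, GEN-9).  NEW WORK of the cell, not a published result; NO definition is
introduced.  Measure-theoretic version, in row 2's vocabulary (`w, q > 0` on an s-finite space,
`rejCurve`), of row 3's finite `Scaling/AcceptanceGiniFloorSharp.lean` (Glasser's `√3·G ≤ CV`,
Arnold 2015 eq. (4.2.117), NAMED ONLY — the proof is the cell's mid-rank Cauchy–Schwarz) and
`Scaling/AcceptanceEssEnvelope.lean` (the envelope); it imports the mid-rank toolkit
`Scaling/MidrankIntegral.lean` (`E_q g = 0`, `E_q g² ≤ 1/3`) and Part II of the 8/9 law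
`Scaling/AcceptanceEssEightNinthsDensities.lean`.  These were listed as NOT CLAIMED
("measure-theoretic versions of the 8/9, overlap and envelope laws") in row 3's GEN-8 files.

## What is proved (`(X, μ)` s-finite; `w, q > 0` measurable, `w` integrable, `∫ q dμ = 1`,
## `Z = ∫ w`, `b = w/q`, `W₂ = ∫ b w < ∞`, `κ = Z²/W₂`; `A = ∫∫ min(w(x)q(y), w(y)q(x))`,
## `ā = A/Z` the equilibrium acceptance; `g(x) = ∫ sign(b x − b y) q(y) dμ` the mid-rank)

* **`integral_midrank_mul_weight_eq`** — `∫ g w dμ = Z − A` (`E_q[b g] = ½E_{q⊗q}|b − b′|`;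
  product measure, one antisymmetric Fubini swap);
* `integral_integral_min_mul_eq_meanAccept` — `A = ∫ (1 − λ(b)) w dμ` (`λ = rejCurve μ w q`);
* **`three_mul_sq_sub_overlap_add_sq_le`** — `3(Z − A)² + Z² ≤ W₂`, i.e. `3Γ² ≤ Var_q b` with
  `Γ = Z − A`: expand `0 ≤ E_q[((b − Z) − 3Γ g)²] = Var_q b − 6Γ² + 9Γ²·E_q g²`, `E_q g² ≤ 1/3`;
* `sq_one_sub_meanAccept_le_third` — `(1 − ā)² ≤ (1/κ − 1)/3`;
* **`one_sub_sqrt_third_mul_le_meanAccept`** — `Z(1 − √((1/κ − 1)/3)) ≤ ∫ (1 − λ(b)) w dμ`;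
  `one_sub_sqrt_third_le_meanAccept_overlapForm` — normalised (`p = w/Z`):
  `1 − √((1/κ − 1)/3) ≤ ∫∫ min(p(x)q(y), p(y)q(x))`;
* **`meanAccept_envelope`** — `max((8/9)κ, 1 − √((1/κ − 1)/3)) ≤ ∫∫ min(p(x)q(y), p(y)q(x))`;
  **`phi4Flow_meanAccept_envelope`** — the same for row 2's φ⁴ flow sampler.

Reading (no numerics implied): on the state spaces the flow samplers live on (`ℝ^Λ`, gauge
fields) the acceptance and ESS columns obey BOTH sharp floors (`κ̂ = 0.9 ⇒ ā ≥ 0.808`,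
`κ̂ = 0.5 ⇒ ā ≥ 0.444`), crossing at `κ = 3/4`.  NOT CLAIMED: attainment of the Gini piece on a
general space; any number of ours; nothing re-scored.
-/

namespace Summit.Ventures.LatticeQCDFlow.Theory2

open MeasureTheory Set
open Summit.Ventures.LatticeQCDFlow.Exactness

section Densities

variable {X : Type*} [MeasurableSpace X] {μ : Measure X} [SFinite μ] {w q : X → ℝ}

/-- **Gini mean difference = covariance with the mid-rank** (general space):
`∫ g(x) w(x) dμ = Z − ∫∫ min(w(x)q(y), w(y)q(x))`, i.e. `E_q[b·g(b)] = ½ E_{q⊗q}|b − b′|`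
(`Z = ∫ w`, `g` the mid-rank functional of `Scaling/MidrankIntegral.lean`). -/
theorem integral_midrank_mul_weight_eq (hw0 : ∀ t, 0 < w t) (hwm : Measurable w)
    (hwi : Integrable w μ) (hq0 : ∀ t, 0 < q t) (hqm : Measurable q) (hqi : Integrable q μ)
    (hq1 : ∫ z, q z ∂μ = 1) :
    ∫ x, (∫ y, Real.sign (w x / q x - w y / q y) * q y ∂μ) * w x ∂μ
      = (∫ z, w z ∂μ) - ∫ x, ∫ y, min (w x * q y) (w y * q x) ∂μ ∂μ := by
  -- product-measure bookkeeping: `u = w₁ q₂`, `v = w₂ q₁`, the one-sided excess `D = (u − v)⁺`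
  -- and the antisymmetric remainder `K = v·𝟙(v<u) − u·𝟙(u<v)`
  have hum : Measurable fun p : X × X => w p.1 * q p.2 :=
    (hwm.comp measurable_fst).mul (hqm.comp measurable_snd)
  have hvm : Measurable fun p : X × X => w p.2 * q p.1 :=
    (hwm.comp measurable_snd).mul (hqm.comp measurable_fst)
  have IU : Integrable (fun p : X × X => w p.1 * q p.2) (μ.prod μ) := hwi.mul_prod hqi
  have IV : Integrable (fun p : X × X => w p.2 * q p.1) (μ.prod μ) := by
    refine (hqi.mul_prod hwi).congr (Filter.Eventually.of_forall fun p => ?_)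
    show q p.1 * w p.2 = w p.2 * q p.1
    ring
  have hlt : MeasurableSet {p : X × X | w p.2 * q p.1 < w p.1 * q p.2} := measurableSet_lt hvm hum
  have hlt' : MeasurableSet {p : X × X | w p.1 * q p.2 < w p.2 * q p.1} := measurableSet_lt hum hvm
  -- `D`
  have IDm : Measurable fun p : X × X =>
      if w p.2 * q p.1 < w p.1 * q p.2 then w p.1 * q p.2 - w p.2 * q p.1 else 0 :=
    Measurable.ite hlt (hum.sub hvm) measurable_const
  have ID : Integrable (fun p : X × X =>
      if w p.2 * q p.1 < w p.1 * q p.2 then w p.1 * q p.2 - w p.2 * q p.1 else 0) (μ.prod μ) := by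
    refine Integrable.mono' IU IDm.aestronglyMeasurable (Filter.Eventually.of_forall fun p => ?_)
    rw [Real.norm_eq_abs]
    split_ifs with h
    · rw [abs_of_nonneg (by linarith)]
      linarith [mul_nonneg (hw0 p.2).le (hq0 p.1).le]
    · rw [abs_zero]; exact mul_nonneg (hw0 _).le (hq0 _).le
  -- `K`
  have IKm : Measurable fun p : X × X =>
      (if w p.2 * q p.1 < w p.1 * q p.2 then w p.2 * q p.1 else 0)
        - (if w p.1 * q p.2 < w p.2 * q p.1 then w p.1 * q p.2 else 0) :=
    (Measurable.ite hlt hvm measurable_const).sub (Measurable.ite hlt' hum measurable_const)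
  have IK : Integrable (fun p : X × X =>
      (if w p.2 * q p.1 < w p.1 * q p.2 then w p.2 * q p.1 else 0)
        - (if w p.1 * q p.2 < w p.2 * q p.1 then w p.1 * q p.2 else 0)) (μ.prod μ) := by
    have IUV : Integrable (fun p : X × X => w p.1 * q p.2 + w p.2 * q p.1) (μ.prod μ) := IU.add IV
    refine Integrable.mono' IUV IKm.aestronglyMeasurable
      (Filter.Eventually.of_forall fun p => ?_)
    rw [Real.norm_eq_abs]
    have hu := mul_nonneg (hw0 p.1).le (hq0 p.2).le
    have hv := mul_nonneg (hw0 p.2).le (hq0 p.1).le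
    refine abs_le.2 ⟨?_, ?_⟩ <;> split_ifs <;> linarith
  -- the sign integrand `s q₂ w₁ = D + K`
  have hsplit : ∀ p : X × X, Real.sign (w p.1 / q p.1 - w p.2 / q p.2) * q p.2 * w p.1
      = (if w p.2 * q p.1 < w p.1 * q p.2 then w p.1 * q p.2 - w p.2 * q p.1 else 0)
        + ((if w p.2 * q p.1 < w p.1 * q p.2 then w p.2 * q p.1 else 0)
          - (if w p.1 * q p.2 < w p.2 * q p.1 then w p.1 * q p.2 else 0)) := by
    intro p
    have hq1' := hq0 p.1
    have hq2' := hq0 p.2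
    have key : w p.1 / q p.1 - w p.2 / q p.2 = (w p.1 * q p.2 - w p.2 * q p.1) / (q p.1 * q p.2) := by
      field_simp
    rcases lt_trichotomy (w p.2 * q p.1) (w p.1 * q p.2) with h | h | h
    · rw [if_pos h, if_pos h, if_neg (not_lt.2 h.le), key,
        Real.sign_of_pos (div_pos (by linarith) (mul_pos hq1' hq2'))]
      ring
    · rw [if_neg (by rw [h]; exact lt_irrefl _), if_neg (by rw [h]; exact lt_irrefl _),
        if_neg (by rw [h]; exact lt_irrefl _), key, h, sub_self, zero_div, Real.sign_zero]
      ring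
    · rw [if_neg (not_lt.2 h.le), if_neg (not_lt.2 h.le), if_pos h, key,
        Real.sign_of_neg (div_neg_of_neg_of_pos (by linarith) (mul_pos hq1' hq2'))]
      ring
  have IS : Integrable (fun p : X × X => Real.sign (w p.1 / q p.1 - w p.2 / q p.2) * q p.2 * w p.1)
      (μ.prod μ) := by
    have e : (fun p : X × X => Real.sign (w p.1 / q p.1 - w p.2 / q p.2) * q p.2 * w p.1)
        = fun p => (if w p.2 * q p.1 < w p.1 * q p.2 then w p.1 * q p.2 - w p.2 * q p.1 else 0)
          + ((if w p.2 * q p.1 < w p.1 * q p.2 then w p.2 * q p.1 else 0)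
            - (if w p.1 * q p.2 < w p.2 * q p.1 then w p.1 * q p.2 else 0)) := funext hsplit
    rw [e]
    exact ID.add IK
  -- `∫_P K = 0` by antisymmetry
  have hK0 : ∫ p, ((if w p.2 * q p.1 < w p.1 * q p.2 then w p.2 * q p.1 else 0)
        - (if w p.1 * q p.2 < w p.2 * q p.1 then w p.1 * q p.2 else 0)) ∂(μ.prod μ) = 0 := by
    have e1 : ∫ p, ((if w p.2 * q p.1 < w p.1 * q p.2 then w p.2 * q p.1 else 0)
          - (if w p.1 * q p.2 < w p.2 * q p.1 then w p.1 * q p.2 else 0)) ∂(μ.prod μ)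
        = ∫ x, ∫ y, ((if w y * q x < w x * q y then w y * q x else 0)
          - (if w x * q y < w y * q x then w x * q y else 0)) ∂μ ∂μ :=
      integral_prod _ IK
    have e2 := integral_integral_swap (f := fun x y => (if w y * q x < w x * q y then w y * q x else 0)
          - (if w x * q y < w y * q x then w x * q y else 0)) IK
    have e3 : ∫ y, ∫ x, ((if w y * q x < w x * q y then w y * q x else 0)
          - (if w x * q y < w y * q x then w x * q y else 0)) ∂μ ∂μ
        = - ∫ y, ∫ x, ((if w x * q y < w y * q x then w x * q y else 0)
          - (if w y * q x < w x * q y then w y * q x else 0)) ∂μ ∂μ := by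
      rw [← integral_neg]
      refine integral_congr_ae (Filter.Eventually.of_forall fun y => ?_)
      show _ = -_
      rw [← integral_neg]
      refine integral_congr_ae (Filter.Eventually.of_forall fun x => ?_)
      show ((if w y * q x < w x * q y then w y * q x else 0)
          - (if w x * q y < w y * q x then w x * q y else 0))
        = -((if w x * q y < w y * q x then w x * q y else 0)
          - (if w y * q x < w x * q y then w y * q x else 0))
      ring
    rw [e1]
    linarith [e2, e3]
  -- assemble: `∫ g w = ∫_P (D + K) = ∫_P D`, `A = ∫_P (u − D) = Z − ∫_P D`
  have hgw : ∫ x, (∫ y, Real.sign (w x / q x - w y / q y) * q y ∂μ) * w x ∂μ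
      = ∫ p, Real.sign (w p.1 / q p.1 - w p.2 / q p.2) * q p.2 * w p.1 ∂(μ.prod μ) := by
    rw [integral_prod _ IS]
    refine integral_congr_ae (Filter.Eventually.of_forall fun x => ?_)
    show (∫ y, Real.sign (w x / q x - w y / q y) * q y ∂μ) * w x
      = ∫ y, Real.sign (w x / q x - w y / q y) * q y * w x ∂μ
    rw [integral_mul_const]
  have hA : ∫ x, ∫ y, min (w x * q y) (w y * q x) ∂μ ∂μ
      = ∫ p, (w p.1 * q p.2
        - (if w p.2 * q p.1 < w p.1 * q p.2 then w p.1 * q p.2 - w p.2 * q p.1 else 0)) ∂(μ.prod μ) := by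
    have IUD : Integrable (fun p : X × X => w p.1 * q p.2
        - (if w p.2 * q p.1 < w p.1 * q p.2 then w p.1 * q p.2 - w p.2 * q p.1 else 0)) (μ.prod μ) :=
      IU.sub ID
    rw [integral_prod _ IUD]
    refine integral_congr_ae (Filter.Eventually.of_forall fun x => ?_)
    refine integral_congr_ae (Filter.Eventually.of_forall fun y => ?_)
    show min (w x * q y) (w y * q x)
      = w x * q y - (if w y * q x < w x * q y then w x * q y - w y * q x else 0)
    split_ifs with h
    · rw [min_eq_right h.le]; ring
    · rw [min_eq_left (not_lt.1 h)]; ring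
  have hZ : ∫ p, w p.1 * q p.2 ∂(μ.prod μ) = ∫ z, w z ∂μ := by
    rw [integral_prod _ IU]
    have e : ∀ x, ∫ y, w x * q y ∂μ = w x := fun x => by
      show ∫ y, w x * q y ∂μ = w x
      rw [integral_const_mul, hq1, mul_one]
    exact integral_congr_ae (Filter.Eventually.of_forall e)
  rw [hgw, hA, integral_sub IU ID, hZ, integral_congr_ae (Filter.Eventually.of_forall hsplit),
    integral_add ID IK, hK0]
  ring

omit [SFinite μ] in
/-- `∫∫ min(w(x)q(y), w(y)q(x)) = ∫ (1 − λ(b)) w dμ`: the unnormalised overlap is `Z` times the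
equilibrium acceptance `ā = E_π[1 − λ(b)]` (`λ = rejCurve μ w q`, row 2's rejection curve). -/
theorem integral_integral_min_mul_eq_meanAccept (hw0 : ∀ t, 0 < w t) (hwm : Measurable w)
    (hq0 : ∀ t, 0 < q t) (hqm : Measurable q) (hqi : Integrable q μ) (hq1 : ∫ z, q z ∂μ = 1) :
    ∫ x, ∫ y, min (w x * q y) (w y * q x) ∂μ ∂μ = ∫ x, (1 - rejCurve μ w q (w x / q x)) * w x ∂μ := by
  rw [meanAccept_eq hw0 hq0]
  refine integral_congr_ae (Filter.Eventually.of_forall fun x => ?_)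
  show (∫ y, min 1 (w y * q x / (w x * q y)) * q y ∂μ) * w x = (1 - rejCurve μ w q (w x / q x)) * w x
  congr 1
  have hb0 : 0 < w x / q x := div_pos (hw0 x) (hq0 x)
  have hint := integrable_rejCurve_integrand hw0 hwm hq0 hqm hqi hb0 (μ := μ)
  have e : ∀ y, min 1 (w y * q x / (w x * q y)) * q y
      = q y - (1 - min 1 (w y / q y / (w x / q x))) * q y := by
    intro y
    have hqy := (hq0 y).ne'
    have hqx := (hq0 x).ne'
    have hwx := (hw0 x).ne'
    have e1 : w y * q x / (w x * q y) = w y / q y / (w x / q x) := by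
      field_simp
    rw [e1]
    ring
  simp_rw [e]
  rw [integral_sub hqi hint, hq1]
  rfl

/-- **GLASSER'S INEQUALITY ON A GENERAL SPACE**: `3·(Z − ∫∫ min(w(x)q(y), w(y)q(x)))² + Z² ≤ W₂`,
i.e. with `Γ = ½E_{q⊗q}|b − b′| = Z(1 − ā)` and `Var_q b = W₂ − Z²`: `3Γ² ≤ Var_q b`
(`√3·G ≤ CV`).  Proof: `0 ≤ E_q[((b − Z) − 3Γ·g)²] = Var_q b − 6Γ·E_q[b g] + 9Γ²·E_q g²` with
`E_q[b g] = Γ` (`integral_midrank_mul_weight_eq`), `E_q g = 0`, `E_q g² ≤ 1/3`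
(`Scaling/MidrankIntegral.lean`).  Finite twin: row 3's `sq_qq_abs_weight_le_sharp`. -/
theorem three_mul_sq_sub_overlap_add_sq_le (hw0 : ∀ t, 0 < w t) (hwm : Measurable w)
    (hwi : Integrable w μ) (hq0 : ∀ t, 0 < q t) (hqm : Measurable q) (hqi : Integrable q μ)
    (hq1 : ∫ z, q z ∂μ = 1) (hW₂ : Integrable (fun x => w x / q x * w x) μ) :
    3 * ((∫ z, w z ∂μ) - ∫ x, ∫ y, min (w x * q y) (w y * q x) ∂μ ∂μ) ^ 2 + (∫ z, w z ∂μ) ^ 2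
      ≤ ∫ z, w z / q z * w z ∂μ := by
  set Z : ℝ := ∫ z, w z ∂μ with hZ
  set W : ℝ := ∫ z, w z / q z * w z ∂μ with hW
  set A : ℝ := ∫ x, ∫ y, min (w x * q y) (w y * q x) ∂μ ∂μ with hA
  set g : X → ℝ := fun x => ∫ y, Real.sign (w x / q x - w y / q y) * q y ∂μ with hg
  have hgm : Measurable g := measurable_midrank hwm hqm
  have hg1 : ∀ x, |g x| ≤ 1 := fun x => abs_midrank_le_one hwm hq0 hqm hqi hq1 x
  have E0 : ∫ x, g x * q x ∂μ = 0 := integral_midrank_mul_eq_zero hwm hq0 hqm hqi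
  have E1 : ∫ x, g x * w x ∂μ = Z - A := integral_midrank_mul_weight_eq hw0 hwm hwi hq0 hqm hqi hq1
  have E2 : ∫ x, g x ^ 2 * q x ∂μ ≤ 1 / 3 := integral_midrank_sq_mul_le hwm hq0 hqm hqi hq1
  -- integrable pieces
  have Igw : Integrable (fun x => g x * w x) μ := by
    refine Integrable.mono' hwi (hgm.mul hwm).aestronglyMeasurable
      (Filter.Eventually.of_forall fun x => ?_)
    rw [Real.norm_eq_abs, abs_mul, abs_of_pos (hw0 x)]
    exact mul_le_of_le_one_left (hw0 x).le (hg1 x)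
  have Igq : Integrable (fun x => g x * q x) μ := by
    refine Integrable.mono' hqi (hgm.mul hqm).aestronglyMeasurable
      (Filter.Eventually.of_forall fun x => ?_)
    rw [Real.norm_eq_abs, abs_mul, abs_of_pos (hq0 x)]
    exact mul_le_of_le_one_left (hq0 x).le (hg1 x)
  have Ig2q : Integrable (fun x => g x ^ 2 * q x) μ := by
    refine Integrable.mono' hqi ((hgm.pow_const 2).mul hqm).aestronglyMeasurable
      (Filter.Eventually.of_forall fun x => ?_)
    rw [Real.norm_eq_abs, abs_mul, abs_of_pos (hq0 x), abs_pow]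
    exact mul_le_of_le_one_left (hq0 x).le (pow_le_one₀ (abs_nonneg _) (hg1 x))
  -- the three grouped integrals
  have IT1 : Integrable (fun x => w x / q x * w x - 2 * Z * w x + Z ^ 2 * q x) μ :=
    (hW₂.sub (hwi.const_mul _)).add (hqi.const_mul _)
  have IT2 : Integrable (fun x => g x * w x - Z * (g x * q x)) μ := Igw.sub (Igq.const_mul _)
  have i1 : ∫ x, (w x / q x * w x - 2 * Z * w x + Z ^ 2 * q x) ∂μ = W - 2 * Z * Z + Z ^ 2 := by
    have h12 : Integrable (fun x => w x / q x * w x - 2 * Z * w x) μ := hW₂.sub (hwi.const_mul _)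
    rw [integral_add h12 (hqi.const_mul _), integral_sub hW₂ (hwi.const_mul _), integral_const_mul,
      integral_const_mul, hq1, ← hZ, ← hW]
    ring
  have i2 : ∫ x, (g x * w x - Z * (g x * q x)) ∂μ = Z - A := by
    rw [integral_sub Igw (Igq.const_mul _), integral_const_mul, E1, E0]
    ring
  -- expand the square
  have e : ∀ x, ((w x / q x - Z) - 3 * (Z - A) * g x) ^ 2 * q x
      = (w x / q x * w x - 2 * Z * w x + Z ^ 2 * q x) - (6 * (Z - A)) * (g x * w x - Z * (g x * q x))
        + (9 * (Z - A) ^ 2) * (g x ^ 2 * q x) := by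
    intro x
    have hqx := (hq0 x).ne'
    field_simp
    ring
  have hJ : 0 ≤ ∫ x, ((w x / q x - Z) - 3 * (Z - A) * g x) ^ 2 * q x ∂μ :=
    integral_nonneg fun x => mul_nonneg (sq_nonneg _) (hq0 x).le
  have iJ : ∫ x, ((w x / q x - Z) - 3 * (Z - A) * g x) ^ 2 * q x ∂μ
      = (W - 2 * Z * Z + Z ^ 2) - 6 * (Z - A) * (Z - A)
        + 9 * (Z - A) ^ 2 * ∫ x, g x ^ 2 * q x ∂μ := by
    have h12 : Integrable (fun x => (w x / q x * w x - 2 * Z * w x + Z ^ 2 * q x)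
        - (6 * (Z - A)) * (g x * w x - Z * (g x * q x))) μ := IT1.sub (IT2.const_mul _)
    rw [integral_congr_ae (Filter.Eventually.of_forall e), integral_add h12 (Ig2q.const_mul _),
      integral_sub IT1 (IT2.const_mul _), integral_const_mul, integral_const_mul, i1, i2]
  have hD2 : 0 ≤ (Z - A) ^ 2 := sq_nonneg _
  have h9 : 9 * (Z - A) ^ 2 * ∫ x, g x ^ 2 * q x ∂μ ≤ 9 * (Z - A) ^ 2 * (1 / 3) :=
    mul_le_mul_of_nonneg_left E2 (by positivity)
  rw [iJ] at hJ
  nlinarith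

/-- **`(1 − ā)² ≤ (1/κ − 1)/3`** with `ā = ∫∫ min(w(x)q(y), w(y)q(x))/Z` the equilibrium acceptance
and `κ = Z²/W₂` the ESS fraction (finite twin: row 3's `sq_one_sub_accRate_le_third`). -/
theorem sq_one_sub_meanAccept_le_third (hw0 : ∀ t, 0 < w t) (hwm : Measurable w)
    (hwi : Integrable w μ) (hq0 : ∀ t, 0 < q t) (hqm : Measurable q) (hqi : Integrable q μ)
    (hq1 : ∫ z, q z ∂μ = 1) (hW₂ : Integrable (fun x => w x / q x * w x) μ) :
    (1 - (∫ x, ∫ y, min (w x * q y) (w y * q x) ∂μ ∂μ) / ∫ z, w z ∂μ) ^ 2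
      ≤ (((∫ z, w z ∂μ) ^ 2 / ∫ z, w z / q z * w z ∂μ)⁻¹ - 1) / 3 := by
  set Z : ℝ := ∫ z, w z ∂μ with hZ
  set W : ℝ := ∫ z, w z / q z * w z ∂μ with hW
  set A : ℝ := ∫ x, ∫ y, min (w x * q y) (w y * q x) ∂μ ∂μ with hA
  have hZ0 : 0 < Z := integral_pos_of_pos hw0 hwi hq1
  have hW0 : 0 < W := integral_pos_of_pos (fun x => mul_pos (div_pos (hw0 x) (hq0 x)) (hw0 x)) hW₂ hq1
  have main := three_mul_sq_sub_overlap_add_sq_le hw0 hwm hwi hq0 hqm hqi hq1 hW₂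
  rw [← hZ, ← hW, ← hA] at main
  have hZne := hZ0.ne'
  have hWne := hW0.ne'
  have k1 : (1 - A / Z) ^ 2 = (Z - A) ^ 2 / Z ^ 2 := by field_simp
  have k2 : ((Z ^ 2 / W)⁻¹ - 1) / 3 = (W - Z ^ 2) / (3 * Z ^ 2) := by field_simp
  rw [k1, k2, div_le_div_iff₀ (by positivity) (by positivity)]
  nlinarith [sq_nonneg Z]

/-- **THE GINI ACCEPTANCE FLOOR ON A GENERAL SPACE**: `ā ≥ 1 − √((1/κ − 1)/3)`, in row 2's
`rejCurve` form `Z·(1 − √((W₂/Z² − 1)/3)) ≤ ∫ (1 − λ(b)) w dμ` (finite twin: row 3's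
`one_sub_sqrt_third_le_accRate`). -/
theorem one_sub_sqrt_third_mul_le_meanAccept (hw0 : ∀ t, 0 < w t) (hwm : Measurable w)
    (hwi : Integrable w μ) (hq0 : ∀ t, 0 < q t) (hqm : Measurable q) (hqi : Integrable q μ)
    (hq1 : ∫ z, q z ∂μ = 1) (hW₂ : Integrable (fun x => w x / q x * w x) μ) :
    (∫ z, w z ∂μ) * (1 - Real.sqrt ((((∫ z, w z ∂μ) ^ 2 / ∫ z, w z / q z * w z ∂μ)⁻¹ - 1) / 3))
      ≤ ∫ x, (1 - rejCurve μ w q (w x / q x)) * w x ∂μ := by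
  set Z : ℝ := ∫ z, w z ∂μ with hZ
  have hZ0 : 0 < Z := integral_pos_of_pos hw0 hwi hq1
  rw [← integral_integral_min_mul_eq_meanAccept hw0 hwm hq0 hqm hqi hq1]
  set A : ℝ := ∫ x, ∫ y, min (w x * q y) (w y * q x) ∂μ ∂μ with hA
  have h := sq_one_sub_meanAccept_le_third hw0 hwm hwi hq0 hqm hqi hq1 hW₂
  rw [← hZ, ← hA] at h
  have h1 : 1 - A / Z ≤ Real.sqrt ((1 - A / Z) ^ 2) := by
    rw [Real.sqrt_sq_eq_abs]; exact le_abs_self _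
  have h2 := Real.sqrt_le_sqrt h
  have h3 : 1 - Real.sqrt (((Z ^ 2 / ∫ z, w z / q z * w z ∂μ)⁻¹ - 1) / 3) ≤ A / Z := by linarith
  calc Z * (1 - Real.sqrt (((Z ^ 2 / ∫ z, w z / q z * w z ∂μ)⁻¹ - 1) / 3)) ≤ Z * (A / Z) :=
        mul_le_mul_of_nonneg_left h3 hZ0.le
    _ = A := by field_simp

/-- **`ā ≥ 1 − √((1/κ − 1)/3)` in the normalised overlap form** (`p = w/Z`):
`1 − √(((Z²/W₂)⁻¹ − 1)/3) ≤ ∫∫ min(p(x)q(y), p(y)q(x))`. -/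
theorem one_sub_sqrt_third_le_meanAccept_overlapForm (hw0 : ∀ t, 0 < w t) (hwm : Measurable w)
    (hwi : Integrable w μ) (hq0 : ∀ t, 0 < q t) (hqm : Measurable q) (hqi : Integrable q μ)
    (hq1 : ∫ z, q z ∂μ = 1) (hW₂ : Integrable (fun x => w x / q x * w x) μ) :
    1 - Real.sqrt ((((∫ z, w z ∂μ) ^ 2 / ∫ z, w z / q z * w z ∂μ)⁻¹ - 1) / 3)
      ≤ ∫ x, ∫ y, min (w x / (∫ z, w z ∂μ) * q y) (w y / (∫ z, w z ∂μ) * q x) ∂μ ∂μ := by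
  set Z : ℝ := ∫ z, w z ∂μ with hZ
  have hZ0 : 0 < Z := integral_pos_of_pos hw0 hwi hq1
  have h := sq_one_sub_meanAccept_le_third hw0 hwm hwi hq0 hqm hqi hq1 hW₂
  rw [← hZ] at h
  set A : ℝ := ∫ x, ∫ y, min (w x * q y) (w y * q x) ∂μ ∂μ with hA
  have e : ∀ x, ∫ y, min (w x / Z * q y) (w y / Z * q x) ∂μ
      = (∫ y, min (w x * q y) (w y * q x) ∂μ) / Z := by
    intro x
    rw [← integral_div]
    refine integral_congr_ae (Filter.Eventually.of_forall fun y => ?_)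
    show min (w x / Z * q y) (w y / Z * q x) = min (w x * q y) (w y * q x) / Z
    rw [← min_div_div_right hZ0.le]
    congr 1 <;> ring
  simp_rw [e]
  rw [integral_div, ← hA]
  have h1 : 1 - A / Z ≤ Real.sqrt ((1 - A / Z) ^ 2) := by
    rw [Real.sqrt_sq_eq_abs]; exact le_abs_self _
  linarith [Real.sqrt_le_sqrt h]

/-- **THE ACCEPTANCE-VS-ESS ENVELOPE ON A GENERAL SPACE**:
`max((8/9)·κ, 1 − √((1/κ − 1)/3)) ≤ ā` with `κ = Z²/W₂` — both sharp pieces of row 3's finite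
`acceptance_envelope` (`Scaling/AcceptanceEssEnvelope.lean`), now for every s-finite state space
(the `8/9` piece is `meanAccept_overlapForm_ge_eight_ninths_ESS`). -/
theorem meanAccept_envelope (hw0 : ∀ t, 0 < w t) (hwm : Measurable w)
    (hwi : Integrable w μ) (hq0 : ∀ t, 0 < q t) (hqm : Measurable q) (hqi : Integrable q μ)
    (hq1 : ∫ z, q z ∂μ = 1) (hW₂ : Integrable (fun x => w x / q x * w x) μ) :
    max (8 / 9 * ((∫ z, w z ∂μ) ^ 2 / ∫ z, w z / q z * w z ∂μ))
        (1 - Real.sqrt ((((∫ z, w z ∂μ) ^ 2 / ∫ z, w z / q z * w z ∂μ)⁻¹ - 1) / 3))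
      ≤ ∫ x, ∫ y, min (w x / (∫ z, w z ∂μ) * q y) (w y / (∫ z, w z ∂μ) * q x) ∂μ ∂μ := by
  refine max_le ?_ (one_sub_sqrt_third_le_meanAccept_overlapForm hw0 hwm hwi hq0 hqm hqi hq1 hW₂)
  have h := meanAccept_overlapForm_ge_eight_ninths_ESS hw0 hwm hwi hq0 hqm hqi hq1 hW₂
  calc 8 / 9 * ((∫ z, w z ∂μ) ^ 2 / ∫ z, w z / q z * w z ∂μ)
      = 8 * (∫ z, w z ∂μ) ^ 2 / (9 * ∫ z, w z / q z * w z ∂μ) := by ring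
    _ ≤ _ := h

end Densities

/-! ### The lattice: row 2's φ⁴ flow sampler -/

section Lattice

open Summit.Ventures.LatticeQCDFlow.Scoring

variable {n : ℕ}

/-- **THE ENVELOPE FOR THE φ⁴ FLOW SAMPLER**: every `λ > 0`, real `J`, positive measurable model
density `q̃` with `∫ q̃ = 1` and `W₂ = ∫ (e^{−S}/q̃) e^{−S} < ∞`; with `p = e^{−S}/Z` and
`κ = Z²/W₂`: `max((8/9)κ, 1 − √((1/κ − 1)/3)) ≤ ∫∫ min(p(φ)q̃(φ'), p(φ')q̃(φ))`. -/
theorem phi4Flow_meanAccept_envelope {lam : ℝ} (hlam : 0 < lam)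
    (J : Fin (n + 1) → Fin (n + 1) → ℝ) {q : (Fin (n + 1) → ℝ) → ℝ} (hq0 : ∀ φ, 0 < q φ)
    (hqm : Measurable q) (hqi : Integrable q) (hq1 : ∫ φ, q φ = 1)
    (hW₂ : Integrable (fun φ => gibbsWeight J lam φ / q φ * gibbsWeight J lam φ)) :
    max (8 / 9 * ((∫ φ, gibbsWeight J lam φ) ^ 2
          / ∫ φ, gibbsWeight J lam φ / q φ * gibbsWeight J lam φ))
        (1 - Real.sqrt ((((∫ φ, gibbsWeight J lam φ) ^ 2
          / ∫ φ, gibbsWeight J lam φ / q φ * gibbsWeight J lam φ)⁻¹ - 1) / 3))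
      ≤ ∫ φ, ∫ φ', min (gibbsWeight J lam φ / (∫ ψ, gibbsWeight J lam ψ) * q φ')
          (gibbsWeight J lam φ' / (∫ ψ, gibbsWeight J lam ψ) * q φ) :=
  meanAccept_envelope (μ := volume) (fun ψ => gibbsWeight_pos J lam ψ)
    (continuous_gibbsWeight J lam).measurable (integrable_gibbsWeight hlam J) hq0 hqm hqi hq1 hW₂

end Lattice

end Summit.Ventures.LatticeQCDFlow.Theory2
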